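import Summits.QuantumFields.BalabanUV.Beta.GAN24.ExponentialChartPolarisation

/-!
# `BalabanUV.Beta.GAN24.ExponentialChartTower` — binder row G-an2-4 ∕ (CONV-C), route R7 «TWO CURRENCIES», PART 256: THE JET TOWER OF THE EXPONENTIAL CHART OF A REAL CONNECTION AND PART
# 247's `N = 2` OBJECT MADE EXPLICIT — THE BUBBLE AND THE TADPOLE.  Along `U_s = exp(isηX)` (`X` real, every volume, every level) the entrywise jet tower of PART 242's shape
# `v ↦ P(∂^j_s(−w)|_v) + P(∂^j_s(−w)|_v)ᴴ + diag ∂^j_s z|_v` is a genuine tower (`∂_v` raises `j`), passes through `covPert e^{ivηX}` at order `0` (through `0` at `v = 0`), has first letter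
# `a = P(−iX) + P(−iX)ᴴ` and second letter `p₂ = P(−(iX)²∕n) + P(−(iX)²∕n)ᴴ + diag(−Σ_ν((iX_ν)² + (−iX_ν)²))` at `v = 0`, so that (PART 251's `iteratedDeriv_two_inv_readout_curve`)
# `∂²_s|₀[(L^{dk}Q_k(Δ_a^{(k)} + covPert e^{isηX} k)⁻¹Q_kᴴ)⁻¹] = 2·E·X_a·E·X_a·E − 2·E·X_{aa}·E + E·X_{p₂}·E` in PART 238's letter shapes (`E = c_k⁻¹`) — the object whose `LimitRate` END is
# PART 247 at `N = 2`.  PART 257 uses it to identify the diagonal of the one-loop Hessian (unit b2b-balaban-gan24-p3, gen 66; v1; generator `HOME/b2b-balaban-gan24-p3/gen66/records/gen/gen256.py`)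

NOT IN PRINT; OUR PROOF ([folklore] bookkeeping BY NAME over PART 251 (`iteratedDeriv_two_inv_readout_curve`), PART 253 (`jetV_one_expChart`), PART 252 (`expChart₂_snd_zero`,
`covPert_expChart₂_zero_zero`), PART 247 (`expJetV_eq`, `expJetZ_eq`, `expJetZ_eq_zero_one`), PART 245 (`contDiff_expChart_entry`), PART 242 (`contDiff_conn`, `contDiff_zfield`,
`hasDerivAt_iteratedDeriv_scalar`), PART 241 (`hasDerivAt_couplingLetter_curve`), PART 161 (`exists_clm_avgTow`), PART 118 (`isUnit_det_unitCovB_and_opNorm_inv_le`), `isUnit_det_calDalev`,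
`calDalev_inv`, NE2's `covPert_eq`; [Balaban1985BackgroundPropagators] (3.3) p. 390, (3.35) p. 396 and [Balaban1987RG1] (1.20)–(1.22) p. 264 LOCATE the shapes; nothing printed is a hypothesis).
HONEST FRAMING (cell contract, verbatim): «discharging `BetaPertH` makes Bałaban's UV stability UNCONDITIONAL — a real constructive-QFT result; it is NOT the
continuum limit and NOT the Clay problem.»  HONEST DEPENDENCY (verbatim): «continuum YM on T⁴ ⇐ BetaPertH ∧ nine spine estimates (0/9 proved); BetaPertH ⇐
(D1) ∧ (D4) ∧ CAP+tail; G-an2-4 gates asym, D1 and NE2/3/4.»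

WHAT THIS FILE PROVES (0 sorry, 0 `def`; `U^X_s k ν x = exp((I·X k ν x∕n_k)·s)`, `X` REAL, every volume `M`, every level `k`):
* **`hasDerivAt_expChartTower`**, `expChartTower_zero`, `expChartTower_zero_zero`, `expChartTower_one`, `expChartTower_two`;
* **`iteratedDeriv_two_invCov_expChart_eq`** (`∂²_s|₀ = 2·EX_aEX_aE − 2·EX_{aa}E + EX_{p₂}E`).
WHAT IT DOES NOT DO: the END (PART 247 at `N = 2`); the Hessian as a form (PART 257).  SUPPLIER work; NEVER «G-an2-4 closed»; NOT (CONV-C), NOT D1, NOT `BetaPertH`, NOT continuum, NOT Clay.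
Records: `HOME/b2b-balaban-gan24-p3/gen66/README.md`.
-/

noncomputable section

open scoped BigOperators ComplexConjugate Matrix Matrix.Norms.L2Operator
open Filter Topology

namespace Summit.QuantumFields.BalabanUV.Beta.GAN24.ExponentialChartTower

open Literature.MathematicalPhysics.QuantumFieldTheory.Balaban1983to89
open Literature.MathematicalPhysics.QuantumFieldTheory.Balaban1983to89.B5Prop11Plancherel (Tor fine)
open Literature.MathematicalPhysics.QuantumFieldTheory.Balaban1983to89.B5G183RateUnitTower (lev)
open Summit.QuantumFields.BalabanUV.T4Continuum
open Summit.QuantumFields.BalabanUV.T4Continuum.CovariantAveragingTower (avgTow)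
open Summit.QuantumFields.BalabanUV.T4Continuum.BalabanAveragedTowerUnit (idx QBlev calGlev unitCovB)
open Summit.QuantumFields.BalabanUV.T4Continuum.KingPairingPlantedLaw (calDalev calDalev_inv isUnit_det_calDalev)
open Summit.QuantumFields.BalabanUV.T4Continuum.FirstOrderBackgroundModel (Pmodel)
open Summit.QuantumFields.BalabanUV.T4Continuum.AbelianCovariantLaplacian (covPert connV zT covPert_eq negConn)
open Summit.QuantumFields.BalabanUV.Beta.GAN24.EffectiveFormInsertionLaw (isUnit_det_unitCovB_and_opNorm_inv_le)
open Summit.QuantumFields.BalabanUV.Beta.GAN24.BackgroundExpansionTaylor (exists_clm_avgTow)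
open Summit.QuantumFields.BalabanUV.Beta.GAN24.CouplingCurveTaylor (hasDerivAt_couplingLetter_curve)
open Summit.QuantumFields.BalabanUV.Beta.GAN24.CovariantCurveTaylor (contDiff_conn contDiff_zfield hasDerivAt_iteratedDeriv_scalar)
open Summit.QuantumFields.BalabanUV.Beta.GAN24.ExponentialChartJets (contDiff_expChart_entry)
open Summit.QuantumFields.BalabanUV.Beta.GAN24.ExponentialChartCovariantTaylor (expJetV_eq expJetZ_eq expJetZ_eq_zero_one)
open Summit.QuantumFields.BalabanUV.Beta.GAN24.ResolventMixedPartials (iteratedDeriv_two_inv_readout_curve)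
open Summit.QuantumFields.BalabanUV.Beta.GAN24.ExponentialChartMixedJets (covPert_expChart₂_zero_zero expChart₂_snd_zero)
open Summit.QuantumFields.BalabanUV.Beta.GAN24.ExponentialChartMixedBackgrounds (jetV_one_expChart)

variable {d : ℕ} (L : ℕ) [NeZero L] (M : Fin d → ℕ) [hM : ∀ μ, NeZero (M μ)] (a : ℝ) (ha : 0 < a)

/-! ## The jet tower of the exponential chart of a real connection; PART 247's `N = 2` object made explicit -/

section Tower

/-- **`hasDerivAt_expChartTower`** — the entrywise jet tower (PART 242's shape) of the exponential chart of a real connection `X`: for every `j`,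
`∂_v[P(∂^j_s(−w)|_v) + P(∂^j_s(−w)|_v)ᴴ + diag ∂^j_s z|_v] = ` the same at `j + 1` (PART 241's `hasDerivAt_couplingLetter_curve` on `hasDerivAt_iteratedDeriv_scalar`; the entries
      are `C^∞`:
`contDiff_conn ∕ contDiff_zfield ∕ contDiff_expChart_entry`). [folklore] -/
theorem hasDerivAt_expChartTower (X : (k : ℕ) → Fin d → (idx L M k → ℝ)) (k : ℕ) (j : ℕ) (v : ℝ) :
    HasDerivAt (fun v : ℝ => (Pmodel L M (fun k' ν (x : idx L M k') => iteratedDeriv j (fun s : ℝ => connV L M (fun k'' ν' (x' : idx L M k'') => Complex.exp ((Complex.I * ((X k''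
          ν' x' : ℝ) : ℂ) / ((lev L k'' : ℕ) : ℂ)) * ((s : ℝ) : ℂ))) k' ν x) v) k + (Pmodel L M (fun k' ν (x : idx L M k') => iteratedDeriv j (fun s : ℝ => connV L M (fun k'' ν'
          (x' : idx L M k'') => Complex.exp ((Complex.I * ((X k'' ν' x' : ℝ) : ℂ) / ((lev L k'' : ℕ) : ℂ)) * ((s : ℝ) : ℂ))) k' ν x) v) k)ᴴ + Matrix.diagonal ((fun k' (x : idx L M
          k') => iteratedDeriv j (fun s : ℝ => zT L M (fun k'' ν' (x' : idx L M k'') => Complex.exp ((Complex.I * ((X k'' ν' x' : ℝ) : ℂ) / ((lev L k'' : ℕ) : ℂ)) * ((s : ℝ) :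
          ℂ))) k' x) v) k)))
      (Pmodel L M (fun k' ν (x : idx L M k') => iteratedDeriv (j + 1) (fun s : ℝ => connV L M (fun k'' ν' (x' : idx L M k'') => Complex.exp ((Complex.I * ((X k'' ν' x' : ℝ) : ℂ) /
            ((lev L k'' : ℕ) : ℂ)) * ((s : ℝ) : ℂ))) k' ν x) v) k + (Pmodel L M (fun k' ν (x : idx L M k') => iteratedDeriv (j + 1) (fun s : ℝ => connV L M (fun k'' ν' (x' : idx L
            M k'') => Complex.exp ((Complex.I * ((X k'' ν' x' : ℝ) : ℂ) / ((lev L k'' : ℕ) : ℂ)) * ((s : ℝ) : ℂ))) k' ν x) v) k)ᴴ + Matrix.diagonal ((fun k' (x : idx L M k') =>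
            iteratedDeriv (j + 1) (fun s : ℝ => zT L M (fun k'' ν' (x' : idx L M k'') => Complex.exp ((Complex.I * ((X k'' ν' x' : ℝ) : ℂ) / ((lev L k'' : ℕ) : ℂ)) * ((s : ℝ) :
            ℂ))) k' x) v) k)) v := by
  have hcV : ∀ (k' : ℕ) (ν : Fin d) (x : idx L M k') (n : ℕ), ContDiff ℝ n (fun s : ℝ => connV L M (fun k'' ν' (x' : idx L M k'') => Complex.exp ((Complex.I * ((X k'' ν' x' : ℝ) :
        ℂ) / ((lev L k'' : ℕ) : ℂ)) * ((s : ℝ) : ℂ))) k' ν x) := by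
    intro k' ν x n
    simp only [connV, negConn]
    exact (contDiff_conn (fine (lev L k') M) (u := fun s : ℝ => (fun k'' ν' (x' : idx L M k'') => Complex.exp ((Complex.I * ((X k'' ν' x' : ℝ) : ℂ) / ((lev L k'' : ℕ) : ℂ)) * ((s
          : ℝ) : ℂ))) k') (fun ν' i => contDiff_expChart_entry _ n) _ ν x).neg
  have hcZ : ∀ (k' : ℕ) (x : idx L M k') (n : ℕ), ContDiff ℝ n (fun s : ℝ => zT L M (fun k'' ν' (x' : idx L M k'') => Complex.exp ((Complex.I * ((X k'' ν' x' : ℝ) : ℂ) / ((lev L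
        k'' : ℕ) : ℂ)) * ((s : ℝ) : ℂ))) k' x) := by
    intro k' x n
    simp only [zT]
    exact contDiff_zfield (fine (lev L k') M) (u := fun s : ℝ => (fun k'' ν' (x' : idx L M k'') => Complex.exp ((Complex.I * ((X k'' ν' x' : ℝ) : ℂ) / ((lev L k'' : ℕ) : ℂ)) * ((s
          : ℝ) : ℂ))) k') (fun ν' i => contDiff_expChart_entry _ n) _ x
  exact hasDerivAt_couplingLetter_curve L M
    (V := fun (j : ℕ) (v : ℝ) (k' : ℕ) (ν : Fin d) (x : idx L M k') => iteratedDeriv j (fun s : ℝ => connV L M (fun k'' ν' (x' : idx L M k'') => Complex.exp ((Complex.I * ((X k''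
          ν' x' : ℝ) : ℂ) / ((lev L k'' : ℕ) : ℂ)) * ((s : ℝ) : ℂ))) k' ν x) v)
    (Z := fun (j : ℕ) (v : ℝ) (k' : ℕ) (x : idx L M k') => iteratedDeriv j (fun s : ℝ => zT L M (fun k'' ν' (x' : idx L M k'') => Complex.exp ((Complex.I * ((X k'' ν' x' : ℝ) : ℂ)
          / ((lev L k'' : ℕ) : ℂ)) * ((s : ℝ) : ℂ))) k' x) v)
    (fun j s k' μ x => hasDerivAt_iteratedDeriv_scalar (hcV k' μ x) j s) (fun j s k' x => hasDerivAt_iteratedDeriv_scalar (hcZ k' x) j s) k j v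

/-- order zero: the tower passes through `covPert (U^X_v)` (NE2's `covPert_eq`). [folklore] -/
theorem expChartTower_zero (X : (k : ℕ) → Fin d → (idx L M k → ℝ)) (k : ℕ) (v : ℝ) :
    (Pmodel L M (fun k' ν (x : idx L M k') => iteratedDeriv 0 (fun s : ℝ => connV L M (fun k'' ν' (x' : idx L M k'') => Complex.exp ((Complex.I * ((X k'' ν' x' : ℝ) : ℂ) / ((lev L
          k'' : ℕ) : ℂ)) * ((s : ℝ) : ℂ))) k' ν x) v) k + (Pmodel L M (fun k' ν (x : idx L M k') => iteratedDeriv 0 (fun s : ℝ => connV L M (fun k'' ν' (x' : idx L M k'') =>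
          Complex.exp ((Complex.I * ((X k'' ν' x' : ℝ) : ℂ) / ((lev L k'' : ℕ) : ℂ)) * ((s : ℝ) : ℂ))) k' ν x) v) k)ᴴ + Matrix.diagonal ((fun k' (x : idx L M k') => iteratedDeriv
          0 (fun s : ℝ => zT L M (fun k'' ν' (x' : idx L M k'') => Complex.exp ((Complex.I * ((X k'' ν' x' : ℝ) : ℂ) / ((lev L k'' : ℕ) : ℂ)) * ((s : ℝ) : ℂ))) k' x) v) k))
      = covPert L M (fun k'' ν' (x' : idx L M k'') => Complex.exp ((Complex.I * ((X k'' ν' x' : ℝ) : ℂ) / ((lev L k'' : ℕ) : ℂ)) * ((v : ℝ) : ℂ))) k := by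
  simp only [iteratedDeriv_zero]
  exact (covPert_eq L M _ k).symm

/-- order zero at `v = 0`: the base point `U = 1`, `covPert = 0`. [folklore] -/
theorem expChartTower_zero_zero (X : (k : ℕ) → Fin d → (idx L M k → ℝ)) (k : ℕ) :
    (Pmodel L M (fun k' ν (x : idx L M k') => iteratedDeriv 0 (fun s : ℝ => connV L M (fun k'' ν' (x' : idx L M k'') => Complex.exp ((Complex.I * ((X k'' ν' x' : ℝ) : ℂ) / ((lev L
          k'' : ℕ) : ℂ)) * ((s : ℝ) : ℂ))) k' ν x) 0) k + (Pmodel L M (fun k' ν (x : idx L M k') => iteratedDeriv 0 (fun s : ℝ => connV L M (fun k'' ν' (x' : idx L M k'') =>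
          Complex.exp ((Complex.I * ((X k'' ν' x' : ℝ) : ℂ) / ((lev L k'' : ℕ) : ℂ)) * ((s : ℝ) : ℂ))) k' ν x) 0) k)ᴴ + Matrix.diagonal ((fun k' (x : idx L M k') => iteratedDeriv
          0 (fun s : ℝ => zT L M (fun k'' ν' (x' : idx L M k'') => Complex.exp ((Complex.I * ((X k'' ν' x' : ℝ) : ℂ) / ((lev L k'' : ℕ) : ℂ)) * ((s : ℝ) : ℂ))) k' x) 0) k)) = 0 :=
          by
  rw [expChartTower_zero, ← expChart₂_snd_zero L M X X 0]
  exact covPert_expChart₂_zero_zero L M X X k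

/-- order one at `v = 0`: the first letter `P(−iX) + P(−iX)ᴴ + diag 0` (PART 253's `jetV_one_expChart`, PART 247's `expJetZ_eq_zero_one`). [folklore] -/
theorem expChartTower_one (X : (k : ℕ) → Fin d → (idx L M k → ℝ)) (k : ℕ) :
    (Pmodel L M (fun k' ν (x : idx L M k') => iteratedDeriv 1 (fun s : ℝ => connV L M (fun k'' ν' (x' : idx L M k'') => Complex.exp ((Complex.I * ((X k'' ν' x' : ℝ) : ℂ) / ((lev L
          k'' : ℕ) : ℂ)) * ((s : ℝ) : ℂ))) k' ν x) 0) k + (Pmodel L M (fun k' ν (x : idx L M k') => iteratedDeriv 1 (fun s : ℝ => connV L M (fun k'' ν' (x' : idx L M k'') =>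
          Complex.exp ((Complex.I * ((X k'' ν' x' : ℝ) : ℂ) / ((lev L k'' : ℕ) : ℂ)) * ((s : ℝ) : ℂ))) k' ν x) 0) k)ᴴ + Matrix.diagonal ((fun k' (x : idx L M k') => iteratedDeriv
          1 (fun s : ℝ => zT L M (fun k'' ν' (x' : idx L M k'') => Complex.exp ((Complex.I * ((X k'' ν' x' : ℝ) : ℂ) / ((lev L k'' : ℕ) : ℂ)) * ((s : ℝ) : ℂ))) k' x) 0) k))
      = (Pmodel L M (fun k'' ν' (x' : idx L M k'') => -(Complex.I * ((X k'' ν' x' : ℝ) : ℂ))) k + (Pmodel L M (fun k'' ν' (x' : idx L M k'') => -(Complex.I * ((X k'' ν' x' : ℝ) :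
            ℂ))) k)ᴴ + Matrix.diagonal ((fun (k'' : ℕ) (_ : idx L M k'') => (0 : ℂ)) k)) := by
  rw [jetV_one_expChart L M X, expJetZ_eq_zero_one L M X 1 le_rfl]

/-- order two at `v = 0`: the second letter `P(−(iX)²∕n) + P(−(iX)²∕n)ᴴ + diag(−Σ_ν((iX_ν)² + (−iX_ν)²))` (PART 247's `expJetV_eq ∕ expJetZ_eq` in PART 246's shapes). [folklore] -/
theorem expChartTower_two (X : (k : ℕ) → Fin d → (idx L M k → ℝ)) (k : ℕ) :
    (Pmodel L M (fun k' ν (x : idx L M k') => iteratedDeriv 2 (fun s : ℝ => connV L M (fun k'' ν' (x' : idx L M k'') => Complex.exp ((Complex.I * ((X k'' ν' x' : ℝ) : ℂ) / ((lev L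
          k'' : ℕ) : ℂ)) * ((s : ℝ) : ℂ))) k' ν x) 0) k + (Pmodel L M (fun k' ν (x : idx L M k') => iteratedDeriv 2 (fun s : ℝ => connV L M (fun k'' ν' (x' : idx L M k'') =>
          Complex.exp ((Complex.I * ((X k'' ν' x' : ℝ) : ℂ) / ((lev L k'' : ℕ) : ℂ)) * ((s : ℝ) : ℂ))) k' ν x) 0) k)ᴴ + Matrix.diagonal ((fun k' (x : idx L M k') => iteratedDeriv
          2 (fun s : ℝ => zT L M (fun k'' ν' (x' : idx L M k'') => Complex.exp ((Complex.I * ((X k'' ν' x' : ℝ) : ℂ) / ((lev L k'' : ℕ) : ℂ)) * ((s : ℝ) : ℂ))) k' x) 0) k))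
      = (Pmodel L M (fun k'' ν' (x' : idx L M k'') => -((Complex.I * ((X k'' ν' x' : ℝ) : ℂ)) ^ (1 + 1) / ((lev L k'' : ℕ) : ℂ) ^ 1)) k + (Pmodel L M (fun k'' ν' (x' : idx L M
            k'') => -((Complex.I * ((X k'' ν' x' : ℝ) : ℂ)) ^ (1 + 1) / ((lev L k'' : ℕ) : ℂ) ^ 1)) k)ᴴ + Matrix.diagonal ((fun (k'' : ℕ) (x' : idx L M k'') => -((∑ ν',
            ((Complex.I * ((X k'' ν' x' : ℝ) : ℂ)) ^ (0 + 2) + (-(Complex.I * ((X k'' ν' x' : ℝ) : ℂ))) ^ (0 + 2))) / ((lev L k'' : ℕ) : ℂ) ^ 0)) k)) := by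
  have jV : (fun k' ν (x : idx L M k') => iteratedDeriv 2 (fun s : ℝ => connV L M (fun k'' ν' (x' : idx L M k'') => Complex.exp ((Complex.I * ((X k'' ν' x' : ℝ) : ℂ) / ((lev L k''
        : ℕ) : ℂ)) * ((s : ℝ) : ℂ))) k' ν x) 0)
      = (fun k'' ν' (x' : idx L M k'') => -((Complex.I * ((X k'' ν' x' : ℝ) : ℂ)) ^ (1 + 1) / ((lev L k'' : ℕ) : ℂ) ^ 1)) := expJetV_eq L M X 1
  have jZ : (fun k' (x : idx L M k') => iteratedDeriv 2 (fun s : ℝ => zT L M (fun k'' ν' (x' : idx L M k'') => Complex.exp ((Complex.I * ((X k'' ν' x' : ℝ) : ℂ) / ((lev L k'' : ℕ)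
        : ℂ)) * ((s : ℝ) : ℂ))) k' x) 0)
      = (fun (k'' : ℕ) (x' : idx L M k'') => -((∑ ν', ((Complex.I * ((X k'' ν' x' : ℝ) : ℂ)) ^ (0 + 2) + (-(Complex.I * ((X k'' ν' x' : ℝ) : ℂ))) ^ (0 + 2))) / ((lev L k'' : ℕ) :
            ℂ) ^ 0)) := expJetZ_eq L M X 0
  rw [jV, jZ]

/-- **`iteratedDeriv_two_invCov_expChart_eq` — PART 247's `N = 2` OBJECT MADE EXPLICIT: THE BUBBLE AND THE TADPOLE** [our proof]: for every volume, every level `k` and any real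
      connection `X`,
`∂²_s|₀[(L^{dk}Q_k(Δ_a^{(k)} + covPert e^{isηX} k)⁻¹Q_kᴴ)⁻¹] = 2·E·X_a·E·X_a·E − 2·E·X_{aa}·E + E·X_{p₂}·E` with `E = c_k⁻¹`, `a = P(−iX) + P(−iX)ᴴ`,
`p₂ = P(−(iX)²∕n) + P(−(iX)²∕n)ᴴ + diag(−Σ_ν((iX_ν)² + (−iX_ν)²))` (PART 251's `iteratedDeriv_two_inv_readout_curve` on the tower of this file).
[cite: Balaban1985BackgroundPropagators, (3.3) p.390, (3.35) p.396 (shapes); Balaban1987RG1, (1.20)–(1.22) p.264 (shapes)] -/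
theorem iteratedDeriv_two_invCov_expChart_eq (X : (k : ℕ) → Fin d → (idx L M k → ℝ)) (k : ℕ) :
    iteratedDeriv 2 (fun s : ℝ => (avgTow (QBlev L M) ((L : ℝ) ^ d)
          (fun k' => (calDalev L M a ha k' + covPert L M (fun k'' ν' (x' : idx L M k'') => Complex.exp ((Complex.I * ((X k'' ν' x' : ℝ) : ℂ) / ((lev L k'' : ℕ) : ℂ)) * ((s : ℝ) :
                ℂ))) k')⁻¹) k)⁻¹) 0
      =
      (2 : ℂ) • ((unitCovB L M a ha k)⁻¹ * avgTow (QBlev L M) ((L : ℝ) ^ d) (fun k' => calGlev L M a ha k' * (Pmodel L M (fun k'' ν' (x' : idx L M k'') => -(Complex.I * ((X k'' ν'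
            x' : ℝ) : ℂ))) k' + (Pmodel L M (fun k'' ν' (x' : idx L M k'') => -(Complex.I * ((X k'' ν' x' : ℝ) : ℂ))) k')ᴴ + Matrix.diagonal ((fun (k'' : ℕ) (_ : idx L M k'') =>
            (0 : ℂ)) k')) * calGlev L M a ha k') k
          * (unitCovB L M a ha k)⁻¹ * avgTow (QBlev L M) ((L : ℝ) ^ d) (fun k' => calGlev L M a ha k' * (Pmodel L M (fun k'' ν' (x' : idx L M k'') => -(Complex.I * ((X k'' ν' x' :
                ℝ) : ℂ))) k' + (Pmodel L M (fun k'' ν' (x' : idx L M k'') => -(Complex.I * ((X k'' ν' x' : ℝ) : ℂ))) k')ᴴ + Matrix.diagonal ((fun (k'' : ℕ) (_ : idx L M k'') => (0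
                : ℂ)) k')) * calGlev L M a ha k') k
          * (unitCovB L M a ha k)⁻¹)
        - (2 : ℂ) • ((unitCovB L M a ha k)⁻¹ * avgTow (QBlev L M) ((L : ℝ) ^ d) (fun k' => calGlev L M a ha k' * (Pmodel L M (fun k'' ν' (x' : idx L M k'') => -(Complex.I * ((X
              k'' ν' x' : ℝ) : ℂ))) k' + (Pmodel L M (fun k'' ν' (x' : idx L M k'') => -(Complex.I * ((X k'' ν' x' : ℝ) : ℂ))) k')ᴴ + Matrix.diagonal ((fun (k'' : ℕ) (_ : idx L M
              k'') => (0 : ℂ)) k')) * (calGlev L M a ha k' * (Pmodel L M (fun k'' ν' (x' : idx L M k'') => -(Complex.I * ((X k'' ν' x' : ℝ) : ℂ))) k' + (Pmodel L M (fun k'' ν' (x'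
              : idx L M k'') => -(Complex.I * ((X k'' ν' x' : ℝ) : ℂ))) k')ᴴ + Matrix.diagonal ((fun (k'' : ℕ) (_ : idx L M k'') => (0 : ℂ)) k')) * calGlev L M a ha k')) k
          * (unitCovB L M a ha k)⁻¹)
        + (unitCovB L M a ha k)⁻¹ * avgTow (QBlev L M) ((L : ℝ) ^ d) (fun k' => calGlev L M a ha k' * (Pmodel L M (fun k'' ν' (x' : idx L M k'') => -((Complex.I * ((X k'' ν' x' :
              ℝ) : ℂ)) ^ (1 + 1) / ((lev L k'' : ℕ) : ℂ) ^ 1)) k' + (Pmodel L M (fun k'' ν' (x' : idx L M k'') => -((Complex.I * ((X k'' ν' x' : ℝ) : ℂ)) ^ (1 + 1) / ((lev L k'' :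
              ℕ) : ℂ) ^ 1)) k')ᴴ + Matrix.diagonal ((fun (k'' : ℕ) (x' : idx L M k'') => -((∑ ν', ((Complex.I * ((X k'' ν' x' : ℝ) : ℂ)) ^ (0 + 2) + (-(Complex.I * ((X k'' ν' x' :
              ℝ) : ℂ))) ^ (0 + 2))) / ((lev L k'' : ℕ) : ℂ) ^ 0)) k')) * calGlev L M a ha k') k
          * (unitCovB L M a ha k)⁻¹ := by
  obtain ⟨Φ, hΦ⟩ := exists_clm_avgTow (QBlev L M) ((L : ℝ) ^ d) k
  have hF : ∀ s : ℝ, (avgTow (QBlev L M) ((L : ℝ) ^ d)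
          (fun k' => (calDalev L M a ha k' + covPert L M (fun k'' ν' (x' : idx L M k'') => Complex.exp ((Complex.I * ((X k'' ν' x' : ℝ) : ℂ) / ((lev L k'' : ℕ) : ℂ)) * ((s : ℝ) :
                ℂ))) k')⁻¹) k)⁻¹
      = (Φ (calDalev L M a ha k + (Pmodel L M (fun k' ν (x : idx L M k') => iteratedDeriv 0 (fun s : ℝ => connV L M (fun k'' ν' (x' : idx L M k'') => Complex.exp ((Complex.I * ((X
            k'' ν' x' : ℝ) : ℂ) / ((lev L k'' : ℕ) : ℂ)) * ((s : ℝ) : ℂ))) k' ν x) s) k + (Pmodel L M (fun k' ν (x : idx L M k') => iteratedDeriv 0 (fun s : ℝ => connV L M (fun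
            k'' ν' (x' : idx L M k'') => Complex.exp ((Complex.I * ((X k'' ν' x' : ℝ) : ℂ) / ((lev L k'' : ℕ) : ℂ)) * ((s : ℝ) : ℂ))) k' ν x) s) k)ᴴ + Matrix.diagonal ((fun k' (x
            : idx L M k') => iteratedDeriv 0 (fun s : ℝ => zT L M (fun k'' ν' (x' : idx L M k'') => Complex.exp ((Complex.I * ((X k'' ν' x' : ℝ) : ℂ) / ((lev L k'' : ℕ) : ℂ)) *
            ((s : ℝ) : ℂ))) k' x) s) k)))⁻¹)⁻¹ := fun s => by
    rw [hΦ, expChartTower_zero]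
  simp only [hF]
  have h00 := expChartTower_zero_zero L M X k
  have ec : Φ (calGlev L M a ha k) = unitCovB L M a ha k := (hΦ (calGlev L M a ha)).symm
  have h0 : IsUnit (calDalev L M a ha k + (Pmodel L M (fun k' ν (x : idx L M k') => iteratedDeriv 0 (fun s : ℝ => connV L M (fun k'' ν' (x' : idx L M k'') => Complex.exp
        ((Complex.I * ((X k'' ν' x' : ℝ) : ℂ) / ((lev L k'' : ℕ) : ℂ)) * ((s : ℝ) : ℂ))) k' ν x) 0) k + (Pmodel L M (fun k' ν (x : idx L M k') => iteratedDeriv 0 (fun s : ℝ =>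
        connV L M (fun k'' ν' (x' : idx L M k'') => Complex.exp ((Complex.I * ((X k'' ν' x' : ℝ) : ℂ) / ((lev L k'' : ℕ) : ℂ)) * ((s : ℝ) : ℂ))) k' ν x) 0) k)ᴴ + Matrix.diagonal
        ((fun k' (x : idx L M k') => iteratedDeriv 0 (fun s : ℝ => zT L M (fun k'' ν' (x' : idx L M k'') => Complex.exp ((Complex.I * ((X k'' ν' x' : ℝ) : ℂ) / ((lev L k'' : ℕ) :
        ℂ)) * ((s : ℝ) : ℂ))) k' x) 0) k))).det := by
    rw [h00, add_zero]
    exact isUnit_det_calDalev L M a ha k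
  have hc0 : IsUnit (Φ (calDalev L M a ha k + (Pmodel L M (fun k' ν (x : idx L M k') => iteratedDeriv 0 (fun s : ℝ => connV L M (fun k'' ν' (x' : idx L M k'') => Complex.exp
        ((Complex.I * ((X k'' ν' x' : ℝ) : ℂ) / ((lev L k'' : ℕ) : ℂ)) * ((s : ℝ) : ℂ))) k' ν x) 0) k + (Pmodel L M (fun k' ν (x : idx L M k') => iteratedDeriv 0 (fun s : ℝ =>
        connV L M (fun k'' ν' (x' : idx L M k'') => Complex.exp ((Complex.I * ((X k'' ν' x' : ℝ) : ℂ) / ((lev L k'' : ℕ) : ℂ)) * ((s : ℝ) : ℂ))) k' ν x) 0) k)ᴴ + Matrix.diagonal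
        ((fun k' (x : idx L M k') => iteratedDeriv 0 (fun s : ℝ => zT L M (fun k'' ν' (x' : idx L M k'') => Complex.exp ((Complex.I * ((X k'' ν' x' : ℝ) : ℂ) / ((lev L k'' : ℕ) :
        ℂ)) * ((s : ℝ) : ℂ))) k' x) 0) k)))⁻¹).det := by
    rw [h00, add_zero, calDalev_inv, ec]
    exact (isUnit_det_unitCovB_and_opNorm_inv_le L M a ha k).1
  rw [iteratedDeriv_two_inv_readout_curve (calDalev L M a ha k) Φ
    (Pd := fun (j : ℕ) (v : ℝ) => (Pmodel L M (fun k' ν (x : idx L M k') => iteratedDeriv j (fun s : ℝ => connV L M (fun k'' ν' (x' : idx L M k'') => Complex.exp ((Complex.I * ((X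
          k'' ν' x' : ℝ) : ℂ) / ((lev L k'' : ℕ) : ℂ)) * ((s : ℝ) : ℂ))) k' ν x) v) k + (Pmodel L M (fun k' ν (x : idx L M k') => iteratedDeriv j (fun s : ℝ => connV L M (fun k''
          ν' (x' : idx L M k'') => Complex.exp ((Complex.I * ((X k'' ν' x' : ℝ) : ℂ) / ((lev L k'' : ℕ) : ℂ)) * ((s : ℝ) : ℂ))) k' ν x) v) k)ᴴ + Matrix.diagonal ((fun k' (x : idx
          L M k') => iteratedDeriv j (fun s : ℝ => zT L M (fun k'' ν' (x' : idx L M k'') => Complex.exp ((Complex.I * ((X k'' ν' x' : ℝ) : ℂ) / ((lev L k'' : ℕ) : ℂ)) * ((s : ℝ) :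
          ℂ))) k' x) v) k)))
    (hasDerivAt_expChartTower L M X k) h0 hc0]
  have hX1 : ∀ C : (k' : ℕ) → Matrix (idx L M k') (idx L M k') ℂ,
      Φ (calGlev L M a ha k * C k * calGlev L M a ha k) = avgTow (QBlev L M) ((L : ℝ) ^ d) (fun k' => calGlev L M a ha k' * C k' * calGlev L M a ha k') k :=
    fun C => (hΦ (fun k' => calGlev L M a ha k' * C k' * calGlev L M a ha k')).symm
  have hX2 : ∀ C C' : (k' : ℕ) → Matrix (idx L M k') (idx L M k') ℂ,
      Φ (calGlev L M a ha k * C k * calGlev L M a ha k * C' k * calGlev L M a ha k)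
        = avgTow (QBlev L M) ((L : ℝ) ^ d) (fun k' => calGlev L M a ha k' * C k' * (calGlev L M a ha k' * C' k' * calGlev L M a ha k')) k := by
    intro C C'
    rw [show calGlev L M a ha k * C k * calGlev L M a ha k * C' k * calGlev L M a ha k = calGlev L M a ha k * C k * (calGlev L M a ha k * C' k * calGlev L M a ha k) by
      simp only [Matrix.mul_assoc]]
    exact (hΦ (fun k' => calGlev L M a ha k' * C k' * (calGlev L M a ha k' * C' k' * calGlev L M a ha k'))).symm
  simp only [h00, add_zero, calDalev_inv, ec, expChartTower_one, expChartTower_two]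
  rw [hX2 (fun k' => (Pmodel L M (fun k'' ν' (x' : idx L M k'') => -(Complex.I * ((X k'' ν' x' : ℝ) : ℂ))) k' + (Pmodel L M (fun k'' ν' (x' : idx L M k'') => -(Complex.I * ((X k''
        ν' x' : ℝ) : ℂ))) k')ᴴ + Matrix.diagonal ((fun (k'' : ℕ) (_ : idx L M k'') => (0 : ℂ)) k')))
      (fun k' => (Pmodel L M (fun k'' ν' (x' : idx L M k'') => -(Complex.I * ((X k'' ν' x' : ℝ) : ℂ))) k' + (Pmodel L M (fun k'' ν' (x' : idx L M k'') => -(Complex.I * ((X k'' ν'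
            x' : ℝ) : ℂ))) k')ᴴ + Matrix.diagonal ((fun (k'' : ℕ) (_ : idx L M k'') => (0 : ℂ)) k'))),
    hX1 (fun k' => (Pmodel L M (fun k'' ν' (x' : idx L M k'') => -(Complex.I * ((X k'' ν' x' : ℝ) : ℂ))) k' + (Pmodel L M (fun k'' ν' (x' : idx L M k'') => -(Complex.I * ((X k''
          ν' x' : ℝ) : ℂ))) k')ᴴ + Matrix.diagonal ((fun (k'' : ℕ) (_ : idx L M k'') => (0 : ℂ)) k'))),
    hX1 (fun k' => (Pmodel L M (fun k'' ν' (x' : idx L M k'') => -((Complex.I * ((X k'' ν' x' : ℝ) : ℂ)) ^ (1 + 1) / ((lev L k'' : ℕ) : ℂ) ^ 1)) k' + (Pmodel L M (fun k'' ν' (x' :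
          idx L M k'') => -((Complex.I * ((X k'' ν' x' : ℝ) : ℂ)) ^ (1 + 1) / ((lev L k'' : ℕ) : ℂ) ^ 1)) k')ᴴ + Matrix.diagonal ((fun (k'' : ℕ) (x' : idx L M k'') => -((∑ ν',
          ((Complex.I * ((X k'' ν' x' : ℝ) : ℂ)) ^ (0 + 2) + (-(Complex.I * ((X k'' ν' x' : ℝ) : ℂ))) ^ (0 + 2))) / ((lev L k'' : ℕ) : ℂ) ^ 0)) k')))]

end Tower

end Summit.QuantumFields.BalabanUV.Beta.GAN24.ExponentialChartTower

end
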